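import Literature.NumberTheory.Automorphic.SmoothInductionSphericalLine
import Literature.NumberTheory.Automorphic.ParabolicGLProofs
import Literature.NumberTheory.Automorphic.UnitaryGroupBorelInduction
import Literature.NumberTheory.Automorphic.LocalUnitaryIntegralLevel
import HarnessLib

/-!
# `Ind_H^G σ` is admissible when `G = H · C` for a compact `C` and `σ` is finite-dimensional; the principal series of `U(σ, Φ_N)(R)`
# (Bernstein–Zelevinsky 1976 §2.25; Cartier §III.3; Rogawski §4.5, §12.2)

Topic `NumberTheory/Automorphic`.  PROOF FILE (theorems only; no definition, no named fact, no instance, no notation, no `sorry`).  Sequel of ★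
`SmoothInductionSphericalLine` (the LINE `(Ind_H^G χ)^K` for `G = H · K`) on the SAME mechanism with a FINITE set of translates: if `G = H · C` with
`C` compact then for every compact open `K` finitely many cosets `s K` cover `C` (★ `exists_finset_forall_inv_mul_mem`), `G = H · t · K`, and
`f ↦ (f(s))_{s ∈ t}` embeds `(Ind_H^G σ)^K` into `W^t`; so for FINITE-DIMENSIONAL `σ` the smooth induction ★ `smoothIndRep H σ` is ADMISSIBLE —
no hypothesis `NonarchimedeanGroup`∕`CompactSpace (G ⧸ H)`∕closedness∕smoothness of `σ` (cf. the named fact ★ `isAdmissible_smoothInd` and the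
`GL_n` discharge ★ `isAdmissible_parabolicIndGL_holds`, whose Iwasawa + finite-translate skeleton this file abstracts).

* §1 `Representation.eq_zero_of_forall_toFun_eq_zero` (a `K`-fixed `f` vanishing on `t` vanishes when `G = H · t · K`),
  **`Representation.isAdmissible_smoothIndRep_of_isCompact`** (`[Module.Finite k W]`, `C` compact, `G = H · C` ⇒ `(smoothIndRep H σ).IsAdmissible`).
* §2 `U(σ, Φ_N)(R)`: **`UnitaryGroup.isAdmissible_principalSeries`** — the principal series ★ `principalSeries σ J hJ χ = Ind_B^G(χ δ_B^{1/2})` is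
  admissible as soon as `G = B · C` for a compact `C` (Iwasawa), for EVERY character `χ` of the diagonal torus; CM carrier:
  **`isAdmissible_cmPrincipalSeries_of_iwasawa`** (`C = K_v = cmLocalIntegralLevel`, ★ `isCompact_isOpen_cmLocalIntegralLevel`; the Iwasawa
  decomposition `U(Φ_N)(L⁺_v) = B · K_v` enters as the binder `hGK`, supplied by ★ `UnitaryGroupCMLocalIwasawa`).

Use (Hodge-CM programme, rung 4, PLAN.F0P3g4 §24 Z7 (β) «+ admissibility», RULING (V4)(2)): admissibility of `i_G(χ_ξ)` makes its constituents
admissible classes (★ `IrrClass.exists_isConstituentOf_smoothTrace_doubleCoset_of_heckeEigenvector`, ★ `IsSpherical.isSphericalWith_smoothTrace`).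

## References
* I. N. Bernstein, A. V. Zelevinsky, *Representations of the group GL(n, F)*, Russian Math. Surveys 31 (1976), §2.25 [BernsteinZelevinsky1976].
* P. Cartier, *Representations of 𝔭-adic groups: a survey*, PSPM 33.1 (1979), §III.3 [CartierCorvallis1979].
* J. Rogawski, *Automorphic Representations of Unitary Groups in Three Variables* (1990), §4.5 p. 45, §12.2 p. 173 [Rogawski1990].
-/

set_option autoImplicit false

noncomputable section

open NumberField IsDedekindDomain

namespace Representation

variable {k G W : Type*} [Field k] [Group G] [TopologicalSpace G] [IsTopologicalGroup G] [AddCommGroup W] [Module k W]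
  (H : Subgroup G) (σ : Representation k H W)

/-! ## §1 `Ind_H^G σ` is admissible for `G = H · C`, `C` compact, `σ` finite-dimensional -/

variable {H} in
omit [IsTopologicalGroup G] in
/-- A `K`-fixed vector of `Ind_H^G σ` that vanishes on a set of representatives `t` of `H \ G / K` (`G = H · t · K`) is zero:
`f(h s κ) = σ h (f s)`. [cite: BernsteinZelevinsky1976, §2.25] [cite: CartierCorvallis1979, §III.3] -/
theorem eq_zero_of_forall_toFun_eq_zero [SeparatelyContinuousMul G] {K : Subgroup G} {t : Finset G}
    (hdec : ∀ g : G, ∃ h : H, ∃ s ∈ t, ∃ κ ∈ K, g = h * s * κ) {f : SmoothInd H σ} (hf : f ∈ (smoothIndRep H σ).fixedPoints K)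
    (h0 : ∀ s ∈ t, f.toFun s = 0) : f = 0 := by
  refine SmoothInd.ext (funext fun g => ?_)
  obtain ⟨h, s, hs, κ, hκ, rfl⟩ := hdec g
  rw [SmoothInd.toFun_zero, Pi.zero_apply, mul_assoc, f.toFun_subgroup_mul, (mem_fixedPoints_smoothIndRep_iff H K σ f).1 hf κ hκ s,
    h0 s hs, map_zero]

/-- **`Ind_H^G σ` IS ADMISSIBLE when `G = H · C` with `C` compact and `σ` finite-dimensional**: smooth by construction (★ `isSmooth_smoothInd`);
for a compact open `K`, finitely many cosets `s K` (`s ∈ t`) cover `C` (★ `exists_finset_forall_inv_mul_mem`), so `G = H · t · K` and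
`f ↦ (f(s))_{s ∈ t}` is an INJECTIVE linear map `(Ind_H^G σ)^K → W^t` (previous lemma), whence `(Ind_H^G σ)^K` is finite-dimensional.
[cite: BernsteinZelevinsky1976, §2.25] [cite: CartierCorvallis1979, §III.3] -/
theorem isAdmissible_smoothIndRep_of_isCompact [Module.Finite k W] {C : Set G} (hC : IsCompact C)
    (hGC : ∀ g : G, ∃ h : H, ∃ c ∈ C, g = h * c) : (smoothIndRep H σ).IsAdmissible := by
  refine ⟨isSmooth_smoothInd H σ, fun K hK => ?_⟩
  obtain ⟨t, ht⟩ := Literature.NumberTheory.Automorphic.exists_finset_forall_inv_mul_mem hC K.isOpen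
  have hdec : ∀ g : G, ∃ h : H, ∃ s ∈ t, ∃ κ ∈ (K : Subgroup G), g = h * s * κ := fun g => by
    obtain ⟨h, c, hc, rfl⟩ := hGC g
    obtain ⟨s, hs, hsk⟩ := ht c hc
    exact ⟨h, s, hs, s⁻¹ * c, hsk, by rw [mul_assoc, mul_inv_cancel_left]⟩
  -- the evaluation map `f ↦ (f(s))_{s ∈ t}`
  let Φ : (smoothIndRep H σ).fixedPoints (K : Subgroup G) →ₗ[k] (↥t → W) :=
    { toFun := fun f s => (f : SmoothInd H σ).toFun s
      map_add' := fun f f' => funext fun s => by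
        simp only [Submodule.coe_add, SmoothInd.toFun_add, Pi.add_apply]
      map_smul' := fun c f => funext fun s => by
        simp only [Submodule.coe_smul, SmoothInd.toFun_smul, Pi.smul_apply, RingHom.id_apply] }
  refine Module.Finite.of_injective Φ ((injective_iff_map_eq_zero Φ).2 fun f hf => ?_)
  have h0 : ∀ s ∈ t, (f : SmoothInd H σ).toFun s = 0 := fun s hs => congrFun hf ⟨s, hs⟩
  exact Subtype.ext (eq_zero_of_forall_toFun_eq_zero σ hdec f.2 h0)

end Representation

/-! ## §2 The principal series of `U(σ, Φ_N)(R)` and of `U(Φ_N)(L⁺_v)` -/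

namespace Literature.NumberTheory.Automorphic

namespace UnitaryGroup

open scoped MatrixGroups

section Generic

variable {R : Type*} [CommRing R] [TopologicalSpace R] [IsTopologicalRing R] (σ : R →+* R) {N : ℕ}
  (J : Matrix (Fin N) (Fin N) R) (hJ : J = (StdForm.antidiagonal N).over R) [LocallyCompactSpace ↥(borelU σ J)]

/-- **THE PRINCIPAL SERIES IS ADMISSIBLE under Iwasawa `G = B · C`, `C` compact** (`G = U(σ, Φ_N)(R)`, ★ `principalSeries σ J hJ χ =
Ind_B^G(χ δ_B^{1/2})`, ANY character `χ` of the diagonal torus): the inducing representation is one-dimensional.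
[cite: Rogawski1990, §4.5 p. 45; §12.2 p. 173] [cite: BernsteinZelevinsky1976, §2.25] -/
theorem isAdmissible_principalSeries {C : Set ↥(unitaryGroupOfForm σ J)} (hC : IsCompact C)
    (hGC : ∀ g : ↥(unitaryGroupOfForm σ J), ∃ b : ↥(borelTriple σ J hJ).P, ∃ c ∈ C, g = (b : ↥(unitaryGroupOfForm σ J)) * c)
    (χ : ↥(torusU σ J) →* ℂˣ) : (principalSeries σ J hJ χ).IsAdmissible :=
  Representation.isAdmissible_smoothIndRep_of_isCompact _ _ hC hGC

end Generic

section CM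

variable (L : Type) [Field L] [NumberField L] [IsCMField L] (N : ℕ) (v : HeightOneSpectrum (𝓞 ↥(maximalRealSubfield L)))

/-- **`i_G(χ)` IS ADMISSIBLE ON THE CM CARRIER** (`G = U(Φ_N)(L⁺_v) = (cmDatum L N Φ_N).Local v`, `K_v = U(Φ_N)(𝒪_v)` = ★ `cmLocalIntegralLevel`,
compact by ★ `isCompact_isOpen_cmLocalIntegralLevel`), GIVEN the Iwasawa decomposition `G = B · K_v` (binder `hGK`, ★ `UnitaryGroupCMLocalIwasawa`):
★ `cmPrincipalSeries L N v χ` is admissible for EVERY `χ`. [cite: Rogawski1990, §4.5 p. 45; §12.2 p. 173] [cite: BernsteinZelevinsky1976, §2.25] -/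
theorem isAdmissible_cmPrincipalSeries_of_iwasawa
    (hGK : ∀ g : ↥(unitaryGroupOfForm (conjLocal L (IsCMField.complexConj L) v) (cmLocalForm L N v)),
      ∃ h : ↥(cmBorelTriple L N v).P, ∃ κ : ↥(unitaryGroupOfForm (conjLocal L (IsCMField.complexConj L) v) (cmLocalForm L N v)),
        κ ∈ cmLocalIntegralLevel L N (Matrix.of fun i j : Fin N => if i.val + j.val + 1 = N then (1 : L) else 0) v ∧ g = h * κ)
    (χ : ↥(torusU (conjLocal L (IsCMField.complexConj L) v) (cmLocalForm L N v)) →* ℂˣ) :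
    (cmPrincipalSeries L N v χ).IsAdmissible := by
  haveI := locallyCompactSpace_cmBorelU L N v
  have hK := isCompact_isOpen_cmLocalIntegralLevel L N (Matrix.of fun i j : Fin N => if i.val + j.val + 1 = N then (1 : L) else 0) v
  refine isAdmissible_principalSeries (conjLocal L (IsCMField.complexConj L) v) (cmLocalForm L N v) (cmLocalForm_eq_over L N v) hK.1
    (fun g => ?_) χ
  obtain ⟨b, κ, hκ, hg⟩ := hGK g
  exact ⟨b, κ, hκ, hg⟩

end CM

end UnitaryGroup

end Literature.NumberTheory.Automorphic

end
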